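import Literature.Computability.AlgebraicComplexity.BI17TensorDegreeMonoidDivisibilityProofs
import Literature.Computability.AlgebraicComplexity.BLMW11RectangleTwoKroneckerProofs
import HarnessLib

/-!
# BI 2017 Rem. 5.4 (`k₂(δ) = [δ even]`, `E(2) = 4ℕ`) from BLMW 2011 Prop. 8.1 — a bridge

Topic `Computability/AlgebraicComplexity`. Theorem-only; no new facts, no new definitions.

Bürgisser–Ikenmeyer 2017, Rem. 5.4 (typed as the named fact `BI2017_rem_5_4`,
`BI17FundamentalInvariantTensors.lean`) has two clauses: (1) the rectangular Kronecker coefficients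
`k₂(δ) = g((δ,δ),(δ,δ),(δ,δ))` equal `1` for even `δ` and `0` for odd `δ` ("cf. Remmel–Whitehead 1994");
(2) the generic degree monoid `E(2) = 4ℕ`. Clause (2) is PROVED in the tree
(`BI2017_rem_5_4_genericTensorDegreeMonoid`, `BI17TensorDegreeMonoidDivisibilityProofs.lean`). Clause (1)
is the special case `π = (δ,δ)` of Bürgisser–Landsberg–Manivel–Weyman 2011, Prop. 8.1 (typed as the named
fact `BLMW2011_prop_8_1`, `BLMW11KroneckerApproximation.lean`: `g((δδ),(δδ),π) ≠ 0` iff `π` is even of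
length `≤ 4` or odd of length exactly `4`, and then `= 1`): `(δ,δ)` has two parts, both equal to `δ`.
Hence `BLMW2011_prop_8_1 → BI2017_rem_5_4` (`BI2017_rem_5_4_of_BLMW2011_prop_8_1`), and with the
tree's discharge `BLMW2011_prop_8_1_holds` (`BLMW11RectangleTwoKroneckerProofs.lean`) the named fact
`BI2017_rem_5_4` is DISCHARGED (`BI2017_rem_5_4_holds`).

## References

* [BurgisserIkenmeyer2017] P. Bürgisser, C. Ikenmeyer, *Fundamental invariants of orbit closures*,
  J. Algebra 477 (2017), Rem. 5.4.
* [BurgisserEtAl2011] P. Bürgisser, J. M. Landsberg, L. Manivel, J. Weyman, *An overview of mathematical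
  issues arising in the geometric complexity theory approach to VP ≠ VNP*, SIAM J. Comput. 40 (2011),
  §8.3 Prop. 8.1.
-/

namespace Literature.Computability.AlgebraicComplexity

open Literature.NumberTheory.DiophantineGeometry

/-- The parts of the two-row rectangle `(δ, δ)` are all equal to `δ`. [folklore] -/
private theorem eq_of_mem_parts_rectangle_two {δ x : ℕ} (hx : x ∈ (Nat.Partition.rectangle 2 δ).parts) :
    x = δ := by
  rw [Nat.Partition.parts_rectangle, Multiset.mem_filter] at hx
  exact Multiset.eq_of_mem_replicate hx.1

/-- **BI 2017 Rem. 5.4 (1) from BLMW 2011 Prop. 8.1**: `k₂(δ) = 1` if `δ` is even, `0` if `δ` is odd.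
[cite: BurgisserIkenmeyer2017, Rem. 5.4] -/
theorem kronRect_two_of_BLMW2011_prop_8_1 (h : BLMW2011_prop_8_1) (δ : ℕ) :
    kronRect ℂ 2 δ = if Even δ then 1 else 0 := by
  obtain ⟨hiff, hone⟩ := h δ (Nat.Partition.rectangle 2 δ)
  unfold kronRect
  by_cases he : Even δ
  · rw [if_pos he]
    refine hone (hiff.2 (Or.inl ⟨fun x hx => ?_, ?_⟩))
    · rw [eq_of_mem_parts_rectangle_two hx]
      exact he
    · exact (Nat.Partition.card_parts_rectangle_le 2 δ).trans (by norm_num)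
  · rw [if_neg he]
    by_contra hne
    rcases hiff.1 hne with ⟨hev, -⟩ | ⟨-, hcard⟩
    · -- `δ` is odd, hence a nonzero part, hence even by the criterion: contradiction
      have hδ0 : δ ≠ 0 := fun h0 => he (h0 ▸ Even.zero)
      have hmem : δ ∈ (Nat.Partition.rectangle 2 δ).parts := by
        rw [Nat.Partition.parts_rectangle, Multiset.mem_filter]
        exact ⟨Multiset.mem_replicate.2 ⟨by norm_num, rfl⟩, hδ0⟩
      exact he (hev δ hmem)
    · have h2 := Nat.Partition.card_parts_rectangle_le 2 δ
      omega

/-- **BI 2017 Rem. 5.4 from BLMW 2011 Prop. 8.1.** Clause (1) by `kronRect_two_of_BLMW2011_prop_8_1`,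
clause (2) is the tree's `BI2017_rem_5_4_genericTensorDegreeMonoid` (unconditional).
[cite: BurgisserIkenmeyer2017, Rem. 5.4] -/
theorem BI2017_rem_5_4_of_BLMW2011_prop_8_1 (h : BLMW2011_prop_8_1) : BI2017_rem_5_4 :=
  ⟨kronRect_two_of_BLMW2011_prop_8_1 h, BI2017_rem_5_4_genericTensorDegreeMonoid⟩

/-- **Discharge of `BI2017_rem_5_4`** (BI 2017, Rem. 5.4: `k₂(δ) = [δ even]` and `E(2) = 4ℕ`), from
BLMW 2011 Prop. 8.1 (`BLMW2011_prop_8_1_holds`) and the tree's `E(2) = 4ℕ`.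
[cite: BurgisserIkenmeyer2017, Rem. 5.4] -/
theorem BI2017_rem_5_4_holds : BI2017_rem_5_4 :=
  BI2017_rem_5_4_of_BLMW2011_prop_8_1 BLMW2011_prop_8_1_holds

end Literature.Computability.AlgebraicComplexity
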